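/-
Copyright: statement-level skeleton of a published paper (lit-balaban cell, Phase-2 proof seat p26 gen 44). No claims beyond
what the kernel checks below.
-/
import Mathlib
import Literature.MathematicalPhysics.QuantumFieldTheory.Balaban1983to89.B3Eq326FromFeynmanRules
import Literature.MathematicalPhysics.QuantumFieldTheory.Balaban1983to89.B3Sect1Graphs122

/-!
# B3 — T. Bałaban, *(Higgs)₂,₃ quantum fields in a finite volume. III. Renormalization*, CMP **88** (1983) 411–445
[Balaban1983Higgs3] — p. 416 [PDF 6] **the picture ⑦ of (1.22)** — the graph ④ (two vertices (1.8)_{1,0} joined by the A-line and a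
φ-line) WITH A MASS-RENORMALIZATION VERTEX (1.7) «δm²» ON ITS φ-LINE (p18's three-vertex model graph `B3Sect1Graphs122.g122g`) —
**EVALUATED BY THE FEYNMAN RULES**: the general evaluator `B3GraphAmplitudeRules.graphAmp` (FILE 2 of this seat's evaluator lineage;
FILE 1 `B3GraphAmplitude`) RUN on the drawing, in closed form for arbitrary model data / localization weights / line kernels / joint
external field, and — at print's data of p. 416 (*"η = ε … B̃ = 0, g_k = 1"*, all bonds and sites of `T_ε`, the free propagators,
`C^ε_0` symmetric) — COMPARED WITH THE SEVENTH DISPLAYED TERM OF (1.22) restated on the (Higgs)₂,₃ torus carrier: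
`E(⑦) = ½·seventh122T`, sign `+` as printed (FILE 13 of the evaluator; with FILE 3 `B3Eq36TadpoleExpressions` (①②), FILE 5
`B3Eq39FromFeynmanRules` (④) and FILE 11 `B3Eq122FromFeynmanRules` (③⑤⑥ and the comparisons ①②④) ALL SEVEN displayed pictures of
(1.22) are now run through the evaluator against their displayed terms)

statement-level skeleton of published theorems with citation tags; proofs where landed; nothing here is a claim about
the Yang–Mills mass gap

PDF held: `paper:balaban1983-higgs-2-3-quantum-fields-finite-volume` (journal page = PDF page + 410); the display (1.22) p. 416 [PDF 6]
read by this seat as an image on the ×2 render `run/shared/lean/pub/pub-balaban/b2b-balaban-ref1/pages/1983-cmp88-higgs23-III/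
1983-cmp88-higgs23-III-p006-x2.png` (2026-08-24) and on the text layer `p0006.txt`; (1.7) p. 413 [PDF 3] on the text layer `p0003.txt`
L5–7; pp. 413–414 (the vertices, *"each pair is replaced by the corresponding propagator"*) as in FILE 2.

CITATION HEADER (lean-in-tree rule).  lit-balaban TYPED SKELETON (HOME `run/shared/lean/pub/lit-balaban/`), PHASE 2, seat p26 gen 44
(unit `lit-balaban-p26`; the evaluator lineage FILEs 1–12: `B3GraphAmplitude` p361338/p366813, `B3GraphAmplitudeRules` p362438,
`B3Eq36TadpoleExpressions` p363523, `B3ExpansionFromFeynmanRules` p363747/p364487, `B3Eq39FromFeynmanRules` p365665,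
`B3Eq326FromFeynmanRules` p367199, `B3Eq322FromFeynmanRules` p368682, `B3EvaluatorCarrierBridge` p371247, `B3GraphAmplitudeMajorant`
p368098/p369115, `B3Eq122FromFeynmanRules` p369030/p369633/p370093, `B3GraphAmplitudePositionForm` p378154); free-target protocol
G.5-34(d), TAKING announced in HOME/STATUS.md 2026-08-24T10:40:36Z (successor-menu item ⑦ of `HOME/lit-balaban-p26/DESIGN-B3-evaluator.md`).
ROWS **B3.Eq1.19-1.22** (the (1.22) cell, p. 416; head `proved`, fold owner r15) and **B3.Def@420** (*"E(G, {□(v)}, Φ, A) COMPUTED on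
concrete pictures"*) of `HOME/lit-balaban-r15/ROWS-B3.md` — an OPTIONAL located member, zero head weight.  CONSUMES BY NAME, nothing
re-declared: p18's graph `B3Sect1Graphs122.g122g` and its kind function `kind122g` (p248469 lineage); FILE 1's `amp`, `SLeg/VLeg/OLeg`,
`sPairing/vPairing`, `spartner/vpartner`, `spartner_eq_some_iff/_none_iff`, `vpartner_eq_some_iff`, `sRank/vRank/oRank`, `SLine/VLine`,
`ExtSLeg/ExtVLeg`, `Pairing.mate/mate_eq/isLower`, `OutPairing`, `vertexFactor/sLineFactor/vLineFactor/oLineFactor`; FILE 2's `graphAmp`,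
`rulesOf`, `rule17`, `rule18`, `pleg18`, `vlegs`, `basisE`, `basisV`, `inner_basisE`, `extS`, `Model`, `Loc`; FILE 5's `dq`, `vterm`,
`pleg18_basisE`, `vlegs_one_basisV`, `inner_q_q`; FILE 6's `dK1`, `dK1_single`, `sum_dK1_single`, `dK1_zero_free`, `dKernelL`, `dKernelR`,
`dKernelL_of_symm`; the typer's `HiggsLattice.{Params, Site, PBond, ScalarField, VecField, ChargeData, covDeriv}`; r15/p26's
`B3Eq123Counterterms.sig7` (the same term on the `Setup` carrier) is NAMED, not bridged.

THE PRINTED TEXT (verbatim, p. 416 [PDF 6]).  *"We have η = ε (hence L^kε = 1) and the only vertices are (1.6), (1.7) [with δm² instead of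
δm_i²(x)], (1.8), and (1.10) with n′ = 0, B̃ = 0, g_k = 1 (but without any restrictions on n). The propagators are C^ε_0 for the scalar
field and C^ε = (−Δ^ε + μ₀²)^{−1} for the vector field (of course internal indices and vector indices are understood here). Let us write a
few terms of the expansion of Σ^ε: Σ^ε(x−x′) = … − e²Σ_{μ=1}^d q(∂^ε_μC^ε_0∂^{ε*}_μ)(x−x′)qC^ε(x−x′) + …
+ e² Σ_{μ=1}^d Σ_{x″∈T_ε} ε^d q(∂^ε_μC^ε_0)(x−x″)δm²(C^ε_0∂^{ε*}_μ)(x″−x′)qC^ε(x−x′) + … = [seven pictures; the seventh: the line x — δm² — x′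
with the derivative arrows at x and x′ under a wavy A-line from x to x′] + ⋯ (1.22) Here we did not write, and we will not write in the
future, combinatoric factors before the graphs, understanding that they are a part of the graphical description."*  (1.7) p. 413 [PDF 3]:
*"−½ Σ_{x∈Ω₁} η^d δm_i²(x)(L^kε)²|φ′(x)|², δm_i²(x) is one of the renormalization mass counterterms."*  p. 414 [PDF 4]: *"All the A′-legs are
contracted, i.e. they are divided into pairs and each pair is replaced by the corresponding propagator. Some φ′-legs are replaced by
external scalar fields and the remaining are again divided into pairs and each pair is replaced by a propagator"*.  The picture: p18's
`B3Sect1Graphs122` header — *"⑦ the graph ④ with a mass-renormalization vertex (1.7) «δm²» on its φ-line = `g122g`"*; its `other`: the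
differentiated leg of `x` ↔ leg 0 of `x″`, the differentiated leg of `x′` ↔ leg 1 of `x″`, the A′-legs of `x`, `x′` joined, the
undifferentiated φ-legs of `x`, `x′` external.

READING (declared).  (a) The value below is what OUR evaluator (FILE 1's index form `amp` at FILE 2's polarized rules (1.7)/(1.8),
`graphAmp`) returns on p18's DRAWING — one labelled pairing; the two φ-lines are read, as FILE 1 prescribes, from their lower endpoint (the
differentiated leg of the (1.8) vertex, `slower7_iff`) to the (1.7) vertex, so each carries FILE 6's kernel `dK1` (the line kernel
contracted against the covariant derivative of the basis fields at its first index) and, at `x″`, the COMMON internal index of the scalar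
product `|φ′(x″)|²` of (1.7) (`rule17_basisE`).  (b) PRINT'S DATA (§4): all bonds `M.S = T_ε` and all sites `Ω₁ = T_ε`, trivial localization
weights, `g_k = 1`, `L^kε = 1` (`Model.ell = 1`), `B̃ = 0`; the scalar line kernels `C₀ ⊗ 1_N` (`K((x,a),(x′,a′)) = [a = a′]C₀(x,x′)`:
*"internal indices … understood"*), the vector line kernel `δ_{μμ′}C(b₋,b′₋)` (diagonal in the bond directions — the READING of print's
scalar kernel `C^ε` for the A-line; *"vector indices … understood"*); `C₀`, `C` are SUPPLIED two-point kernels (print's `C^ε_0`, `C^ε`; their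
concrete torus instances are p37's `B3Eq122TorusPropagators`), `η = P.mesh 0` plays print's `ε`; the counterterm of the vertex `x″` is the
SITE FUNCTION `dm2` the evaluator carries for every vertex (FILE 2: one counterterm function per vertex) — print's δm² in ⑦ is the
vertex (1.7) *"[with δm² instead of δm_i²(x)]"* (p. 416), i.e. a CONSTANT on `T_ε` at print's data, the constant function being print's
case; `seventh122T` keeps the site function inside the `x″`-sum exactly as r15/p26's `B3Eq123Counterterms.sig7` does.  In the truncation
*"of order ≦ 4"* of p. 417 the picture ⑦ (order `e²` from its two vertices (1.8)_{1,0}) carries, of `δm² = Σ_{2≤α+2β≤4} e^αλ^β δm²_{(α,β)}`,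
only the part `δm₁² = e²δm²_{(2,0)} + λδm²_{(0,1)}` of order `α + 2β = 2` (p. 417: *"where δm₁² denote a sum of terms δm²_{(α,β)} of the order
α + 2β = 2"*; p26 g39's `B3Eq123Counterterms.dm2One` / `ct7_dm2One`, p39's BRICK 10 `B3Eq123RenormalizationConditions` for the (2,0)/(0,1)
equations, BRICK 8 `B3Eq122MassInsertionWick` for the ∂_{m²} reading of the insertion) — a reading note keeping this record consistent
with the B3.Eq1.23 cell; nothing of it is used or re-proved here.  (c) The printed term is RESTATED on the (Higgs)₂,₃ torus carrier as a bilinear form in the two external fields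
(`seventh122T`: print's kernel inserted between `φ(x)` and `φ′(x′)` and summed `Σ_{x,x′} ε^{2d}`, `q…q` as the operator `q²` acting on
`φ′`, `(∂^ε_μC^ε_0)(x−x″)` = FILE 6's `dKernelL` (the forward difference quotient in the FIRST variable, r15's `d1Kernel`),
`(C^ε_0∂^{ε*}_μ)(x″−x′)` = FILE 6's `dKernelR` (in the SECOND variable, r15's `dAdjKernel`)) — «restated», not «identified»; no carrier
bridge is invoked (FILE 8 `B3EvaluatorCarrierBridge` is the bridge pattern).  (d) THE COEFFICIENT AND THE SIGN as the kernel finds them: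
the evaluator differentiates the second φ-line in its first variable at `x′` (`(∂^η_μC₀)(x′,x″)`), which IS print's `(C₀∂^{ε*}_μ)(x″,x′)`
for a SYMMETRIC `C₀` (`dKernelL_of_symm`; print's `C^ε_0 = (−Δ^ε_0 + m²)^{−1}` is symmetric) — a HYPOTHESIS of the comparison theorem;
then `E(⑦) = ½·seventh122T`: the factor `(−e)² = e²` of the two vertices (1.8)_{1,0}, the factor `−½δm²(L^kε)²η^d` of (1.7), and the
closed index chain `qφ·qφ′ = −φ·q²φ′` give `+½`.  The coefficient `c = ½` is OUR evaluator's factor on p18's labelled drawing under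
its leg-ordering convention (`g122g.other`: the differentiated leg of `x` ↔ leg 0 of the (1.7) vertex, the differentiated leg of `x′` ↔ its
leg 1 — ONE of the two attachments of the two legs of `½δm²|φ|²`), NOT a claim about print: p. 416 after (1.22), *"we did not write, and we
will not write in the future, combinatoric factors before the graphs, understanding that they are a part of the graphical description"*;
the decomposition «2 attachments × ½ = print's 1» is this seat's reading, recorded as such.

WHAT IS TYPED / PROVED (definitions with bodies + theorems; no `Prop` fact, no `sorry`; standard axioms `propext`, `Classical.choice`,
`Quot.sound`; `[folklore]` kernels private).  §1 `scalarLegs_kind122g`, `sx` (the six φ′-legs, by cases on the vertex), `vb` (the two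
A′-legs), `sx_cases`, `vb_cases`, `sx_injective2`, `vb_injective`, `vx7`, **`sother7`** (the two φ-lines and the two external legs, p18's
`other` verbatim), **`vother7`** (the A-line), **`slower7_iff`** (lower endpoints = the two differentiated legs), `vlower7_iff`, `la`, `lb`,
`lv`, `la_ne_lb`, **`univ_sline7`** (TWO φ-lines), `uniqueVLine7` (ONE A-line), `mate7`, `instIsEmptyExtVLeg7`, `instIsEmptyOLeg7`,
`instIsEmptyOLeg122g`, `es7` (= p26 g39's `B3Eq123Counterterms.extLeg7`), `es7_ne`, `es7_cases`, **`univ_extSLeg7`**, `gExt`, `gExt_apply`,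
`ext_fun_eq7`, `extS_gExt`, `pairExt7`, `pairExt7_apply`; §2 **`rule17_basisE`** (the polarized (1.7) on basis fields = site delta × site
delta × internal-index delta, any level — the first evaluation of this lineage with the mass-counterterm vertex), **`rule18_basis7x`** /
**`rule18_basis7x'`** (the two (1.8)_{1,0} vertices of ⑦ on basis fields = `−e Σ_{b∈S} vterm`), `rule17_basis7`, `gAssign`, `gAssign_apply`,
`gEquiv`, **`sum_gAssign`** (re-parametrization of the sum over the six-leg index assignments), **`alpha_sum7`** (the sum over the φ′-leg
assignments with the three Kronecker deltas: free indices `c`, `c′` of the external legs, ONE common index `a` at `x″`, the differentiated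
legs over all indices), `bAssign7`, `bAssign7_apply`, **`beta_sum7`**; §3 `graphAmp_eq7`, **`graphAmp_g122g`** (`E = A(∅)Ψ(∅)·e² Σ_{b,b′∈S}
Σ_{x″∈Ω₁} w₀(b)w₁(b′)w₂(x″) η^{3d} g_k(b₋)g_k(b′₋) (−½δm²₂(x″)(L^kε)²) Kv(b,b′) Σ_{c,c′,a} dK1(Ks ℓ_a)(b, qe_c; (x″,a))·dK1(Ks ℓ_b)(b′, qe_{c′};
(x″,a))·Φ((b₋,c),(b′₋,c′))` for ANY model data, weights, kernels, joint external field), **`graphAmp_g122g_extS`** (product external fields: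
`… Σ_a dK1(Ks ℓ_a)(b, qφ₀(b₋); (x″,a))·dK1(Ks ℓ_b)(b′, qφ₁(b′₋); (x″,a))`); §4 **`seventh122T`** (print's seventh term restated),
**`graphAmp_g122g_free`** (`= A(∅)Ψ(∅)·e²((L^kε)²/2)η^{3d} Σ_{x,μ,x′,x″} g₀g_k(x)g₁g_k(x′)g₂(x″)δm²₂(x″)G(x,x′)(∂^η_μG_a)(x,x″)(∂^η_μG_b)(x′,x″)
φ(x)·q²φ′(x′)` at `B̃ = 0` with the free kernels), **`graphAmp_g122g_print`** (`E(⑦) = A(∅)Ψ(∅)·½·seventh122T` at print's data, `C₀`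
symmetric).
HONEST SCOPE.  (a) An evaluation of OUR evaluator on p18's drawing; print displays the analytic term with its combinatoric factor, and the
comparison theorem holds with the ratio `½` of reading (d) — nothing is asserted about the derivation of print's factor from Wick's
theorem, about the «+ …», or about 1PI-ness.  (b) The free kernels, their internal-index / direction structure, the symmetry of `C₀`, all
bonds / all sites, `g_k = 1`, `L^kε = 1`, `B̃ = 0` and trivial weights are HYPOTHESES of the `free`/`print` theorems; §3 holds in general.
(c) The restated term lives on the (Higgs)₂,₃ carrier; `B3Eq123Counterterms.sig7` (the `Setup` carrier, scalar charge factor `q2`) is not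
bridged here, nor is p39's kernel-level mass-insertion identity `B3Eq122MassInsertionWick` (⑦ = ∂_{m²} of ②+④ at fixed C^ε) touched.
(d) Nothing analytic (no propagator property, no `ε → 0` statement).  (e) The attached counterterm graphs (1.23)⑦⑧⑨ (p18's `g123g/h/i`:
④'s φ-line through a (1.6)/(1.10)/(1.8) insertion) and the remaining (3.18) pictures `g318c–f` are not evaluated here.  Unit
`lit-balaban-p26` gen 44 (literature-prover-lit-balaban-p26-g44-0), HOME `run/shared/lean/pub/lit-balaban/`, 2026-08-24.  v1.1 (DOCFIX
N-ref1-g108-1, docstring-only): print's «δm_i²(x)» restored in the three (1.7) quotations (v1.0 wrote «δm²_k(x)», a text-layer slip).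
-/


open Finset
open scoped BigOperators InnerProductSpace

namespace Literature.MathematicalPhysics.QuantumFieldTheory.Balaban1983to89.B3Eq122MassInsertionFromFeynmanRules

open Literature.MathematicalPhysics.QuantumFieldTheory.Balaban1983to89.HiggsLattice (ChargeData covDeriv)
open Literature.MathematicalPhysics.QuantumFieldTheory.Balaban1983to89.B3Prop1 (VertexKind)
open Literature.MathematicalPhysics.QuantumFieldTheory.Balaban1983to89.B3Cor23Concrete (Graph Leg)
open Literature.MathematicalPhysics.QuantumFieldTheory.Balaban1983to89.B3Sect1Graphs122 (g122g kind122g)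
open Literature.MathematicalPhysics.QuantumFieldTheory.Balaban1983to89.B3GraphAmplitude
open Literature.MathematicalPhysics.QuantumFieldTheory.Balaban1983to89.B3GraphAmplitudeRules
open Literature.MathematicalPhysics.QuantumFieldTheory.Balaban1983to89.B3Eq36TadpoleExpressions (basisE_eq)
open Literature.MathematicalPhysics.QuantumFieldTheory.Balaban1983to89.B3Eq39FromFeynmanRules (dq vterm pleg18_basisE vlegs_one_basisV
  inner_basisE_left inner_covDeriv_zero_basisE inner_q_q)
open Literature.MathematicalPhysics.QuantumFieldTheory.Balaban1983to89.B3Eq326FromFeynmanRules (dK1 dK1_single sum_dK1_single dK1_zero_free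
  dKernelL dKernelR dKernelL_of_symm)

noncomputable section

variable {nbar : ℕ}

/-! ## §1 The legs and the lines of the picture ⑦ (p18's `g122g`) in the evaluator's vocabulary -/

section Legs

/-- Every vertex of ⑦ has two φ′-legs: the vertices `x`, `x′` of the kind (1.8)_{1,0} (leg `0` differentiated, leg `1` the leg
`qφ′(b₋)`) and the mass-renormalization vertex (1.7) at `x″` (the two factors of `|φ(x″)|²`). [cite: Balaban1983Higgs3, (1.22) p.416] -/
theorem scalarLegs_kind122g (i : Fin 3) : (kind122g i).scalarLegs = 2 := by
  fin_cases i <;> rfl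

/-- The φ′-leg `j` of the vertex `i` of ⑦ (`i = 0`: `x`, `i = 1`: `x′`, `i = 2`: `x″`), as a φ′-leg of the evaluator (by cases on the
vertex, so that `sx i j` unfolds to the literal leg `⟨i, j⟩` the evaluator produces). [cite: Balaban1983Higgs3, (1.22) p.416] -/
def sx : Fin 3 → Fin 2 → SLeg kind122g
  | 0, j => ⟨0, j⟩
  | 1, j => ⟨1, j⟩
  | 2, j => ⟨2, j⟩

/-- The A′-leg of the vertex `i` (`i = 0`: `x`, `i = 1`: `x′`) of ⑦ — the (1.7) vertex has none. [cite: Balaban1983Higgs3, (1.22) p.416] -/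
def vb : Fin 2 → VLeg kind122g
  | 0 => ⟨0, ⟨0, Nat.one_pos⟩⟩
  | 1 => ⟨1, ⟨0, Nat.one_pos⟩⟩

/-- every φ′-leg of ⑦ is one of the six `sx i j`. [cite: Balaban1983Higgs3, (1.22) p.416] -/
theorem sx_cases : ∀ ℓ : SLeg kind122g,
    ℓ = sx 0 0 ∨ ℓ = sx 1 0 ∨ ℓ = sx 0 1 ∨ ℓ = sx 1 1 ∨ ℓ = sx 2 0 ∨ ℓ = sx 2 1 := by decide

/-- every A′-leg of ⑦ is one of the two `vb i`. [cite: Balaban1983Higgs3, (1.22) p.416] -/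
theorem vb_cases : ∀ ℓ : VLeg kind122g, ℓ = vb 0 ∨ ℓ = vb 1 := by decide

/-- the six φ′-legs are distinct. [cite: Balaban1983Higgs3, (1.22) p.416] -/
theorem sx_injective2 : ∀ i j i' j', sx i j = sx i' j' → i = i' ∧ j = j' := by decide

/-- the two A′-legs are distinct. [cite: Balaban1983Higgs3, (1.22) p.416] -/
theorem vb_injective : Function.Injective vb := by
  intro i j h
  fin_cases i <;> fin_cases j <;> first | rfl | exact absurd h (by decide)

/-- The vertex `i` of ⑦ as a vertex of p18's `g122g`. [cite: Balaban1983Higgs3, (1.22) p.416] -/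
def vx7 (nbar : ℕ) (hn : 1 ≤ nbar) (i : Fin 3) : Fin (g122g nbar hn).nV := i

variable {hn : 1 ≤ nbar}

/-- **The two φ-lines of ⑦** (p18's `g122g.other`, verbatim): the differentiated leg of `x` is joined to the leg `0` of the (1.7)
vertex at `x″`, the differentiated leg of `x′` to its leg `1`; the undifferentiated legs of `x`, `x′` are external.
[cite: Balaban1983Higgs3, (1.22) p.416] -/
theorem sother7 :
    (sPairing (g122g nbar hn)).other (sx 0 0) = some (sx 2 0) ∧ (sPairing (g122g nbar hn)).other (sx 2 0) = some (sx 0 0) ∧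
      (sPairing (g122g nbar hn)).other (sx 1 0) = some (sx 2 1) ∧ (sPairing (g122g nbar hn)).other (sx 2 1) = some (sx 1 0) ∧
        (sPairing (g122g nbar hn)).other (sx 0 1) = none ∧ (sPairing (g122g nbar hn)).other (sx 1 1) = none := by
  refine ⟨?_, ?_, ?_, ?_, ?_, ?_⟩
  · show spartner (g122g nbar hn) (sx 0 0) = some (sx 2 0)
    exact (spartner_eq_some_iff _ _ _).2 rfl
  · show spartner (g122g nbar hn) (sx 2 0) = some (sx 0 0)
    exact (spartner_eq_some_iff _ _ _).2 rfl
  · show spartner (g122g nbar hn) (sx 1 0) = some (sx 2 1)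
    exact (spartner_eq_some_iff _ _ _).2 rfl
  · show spartner (g122g nbar hn) (sx 2 1) = some (sx 1 0)
    exact (spartner_eq_some_iff _ _ _).2 rfl
  · show spartner (g122g nbar hn) (sx 0 1) = none
    exact (spartner_eq_none_iff _ _).2 rfl
  · show spartner (g122g nbar hn) (sx 1 1) = none
    exact (spartner_eq_none_iff _ _).2 rfl

/-- **The A-line of ⑦** joins the A′-legs of `x` and `x′`. [cite: Balaban1983Higgs3, (1.22) p.416] -/
theorem vother7 (i : Fin 2) : (vPairing (g122g nbar hn)).other (vb i) = some (vb i.rev) := by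
  show vpartner (g122g nbar hn) (vb i) = some (vb i.rev)
  refine (vpartner_eq_some_iff _ _ _).2 ?_
  fin_cases i <;> rfl

/-- The lower endpoints among the φ′-legs of ⑦ are the two differentiated legs `sx 0 0`, `sx 1 0` — so BOTH φ-lines are read FROM the
(1.8) vertex TO the (1.7) vertex. [cite: Balaban1983Higgs3, (1.22) p.416] -/
theorem slower7_iff : ∀ ℓ : SLeg (g122g nbar hn).kind,
    (sPairing (g122g nbar hn)).isLower sRank ℓ = true ↔ ℓ = sx 0 0 ∨ ℓ = sx 1 0 := by
  show ∀ ℓ : SLeg (g122g 1 le_rfl).kind, (sPairing (g122g 1 le_rfl)).isLower sRank ℓ = true ↔ ℓ = sx 0 0 ∨ ℓ = sx 1 0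
  decide

/-- `vb 0` is the lower endpoint of the A-line. [cite: Balaban1983Higgs3, (1.22) p.416] -/
theorem vlower7_iff : ∀ ℓ : VLeg (g122g nbar hn).kind, (vPairing (g122g nbar hn)).isLower vRank ℓ = true ↔ ℓ = vb 0 := by
  show ∀ ℓ : VLeg (g122g 1 le_rfl).kind, (vPairing (g122g 1 le_rfl)).isLower vRank ℓ = true ↔ ℓ = vb 0
  decide

/-- The φ-line of ⑦ from the differentiated leg of `x` to `x″` (print's `q(∂^ε_μC^ε_0)(x − x″)`). [cite: Balaban1983Higgs3, (1.22) p.416] -/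
def la (nbar : ℕ) (hn : 1 ≤ nbar) : SLine (g122g nbar hn) := ⟨sx 0 0, (slower7_iff _).2 (Or.inl rfl)⟩

/-- The φ-line of ⑦ from the differentiated leg of `x′` to `x″` (print's `(C^ε_0∂^{ε*}_μ)(x″ − x′)q`). [cite: Balaban1983Higgs3, (1.22) p.416] -/
def lb (nbar : ℕ) (hn : 1 ≤ nbar) : SLine (g122g nbar hn) := ⟨sx 1 0, (slower7_iff _).2 (Or.inr rfl)⟩

/-- The A-line of ⑦ (print's `C^ε(x − x′)`). [cite: Balaban1983Higgs3, (1.22) p.416] -/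
def lv (nbar : ℕ) (hn : 1 ≤ nbar) : VLine (g122g nbar hn) := ⟨vb 0, (vlower7_iff _).2 rfl⟩

/-- the two φ-lines are distinct. [cite: Balaban1983Higgs3, (1.22) p.416] -/
theorem la_ne_lb : la nbar hn ≠ lb nbar hn := by
  intro h
  have h' := congrArg Subtype.val h
  exact absurd (sx_injective2 0 0 1 0 h').1 (by decide)

/-- the φ-lines of ⑦ are exactly `la`, `lb`. [cite: Balaban1983Higgs3, (1.22) p.416] -/
theorem univ_sline7 : (univ : Finset (SLine (g122g nbar hn))) = {la nbar hn, lb nbar hn} := by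
  ext l
  simp only [Finset.mem_univ, Finset.mem_insert, Finset.mem_singleton, true_iff]
  rcases (slower7_iff l.1).1 l.2 with h | h
  · left; exact Subtype.ext h
  · right; exact Subtype.ext h

/-- one A-line. [cite: Balaban1983Higgs3, (1.22) p.416] -/
instance uniqueVLine7 : Unique (VLine (g122g nbar hn)) where
  default := lv nbar hn
  uniq := fun l => Subtype.ext ((vlower7_iff l.1).1 l.2)

/-- the mates: `sx 0 0 ↦ sx 2 0`, `sx 1 0 ↦ sx 2 1`, `vb 0 ↦ vb 1`. [cite: Balaban1983Higgs3, (1.22) p.416] -/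
theorem mate7 : (sPairing (g122g nbar hn)).mate (sx 0 0) = sx 2 0 ∧ (sPairing (g122g nbar hn)).mate (sx 1 0) = sx 2 1 ∧
    (vPairing (g122g nbar hn)).mate (vb 0) = vb 1 :=
  ⟨(sPairing (g122g nbar hn)).mate_eq sother7.1, (sPairing (g122g nbar hn)).mate_eq sother7.2.2.1,
    (vPairing (g122g nbar hn)).mate_eq (vother7 0)⟩

/-- ⑦ has no external A′-leg. [cite: Balaban1983Higgs3, (1.22) p.416] -/
instance instIsEmptyExtVLeg7 : IsEmpty (ExtVLeg (g122g nbar hn)) :=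
  ⟨fun l => by
    have h := l.2
    rcases vb_cases l.1 with e | e <;> rw [e, vother7] at h <;> cases h⟩

/-- no averaging output (the kinds (1.8)_{1,0} and (1.7) have no output slot). [cite: Balaban1983Higgs3, (1.22) p.416] -/
instance instIsEmptyOLeg7 : IsEmpty (OLeg (g122g nbar hn).kind) :=
  ⟨fun ℓ => by
    obtain ⟨i, j⟩ := ℓ
    fin_cases i <;> exact Fin.elim0 j⟩

/-- no averaging output (on the kind function itself). [cite: Balaban1983Higgs3, (1.22) p.416] -/
instance instIsEmptyOLeg122g : IsEmpty (OLeg kind122g) :=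
  ⟨fun ℓ => by
    obtain ⟨i, j⟩ := ℓ
    fin_cases i <;> exact Fin.elim0 j⟩

/-- The external φ′-legs of ⑦: `es7 0` = the undifferentiated leg of `x` (`sx 0 1`), `es7 1` = the undifferentiated leg of `x′`
(`sx 1 1`) — p26 g39's `B3Eq123Counterterms.extLeg7`. [cite: Balaban1983Higgs3, (1.22) p.416] -/
def es7 (nbar : ℕ) (hn : 1 ≤ nbar) : Fin 2 → ExtSLeg (g122g nbar hn)
  | ⟨0, _⟩ => ⟨sx 0 1, sother7.2.2.2.2.1⟩
  | ⟨1, _⟩ => ⟨sx 1 1, sother7.2.2.2.2.2⟩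

/-- `es7 0 ≠ es7 1`. [cite: Balaban1983Higgs3, (1.22) p.416] -/
theorem es7_ne : es7 nbar hn 0 ≠ es7 nbar hn 1 := by
  intro h
  have h' : sx 0 1 = sx 1 1 := congrArg Subtype.val h
  exact absurd (sx_injective2 0 1 1 1 h').1 (by decide)

/-- every external φ′-leg of ⑦ is `es7 0` or `es7 1`. [cite: Balaban1983Higgs3, (1.22) p.416] -/
theorem es7_cases (ℓ : ExtSLeg (g122g nbar hn)) : ℓ = es7 nbar hn 0 ∨ ℓ = es7 nbar hn 1 := by
  have h := ℓ.2
  rcases sx_cases ℓ.1 with e | e | e | e | e | e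
  · rw [e, sother7.1] at h; cases h
  · rw [e, sother7.2.2.1] at h; cases h
  · left; exact Subtype.ext e
  · right; exact Subtype.ext e
  · rw [e, sother7.2.1] at h; cases h
  · rw [e, sother7.2.2.2.1] at h; cases h

/-- the external φ′-legs of ⑦ are exactly `es7 0`, `es7 1`. [cite: Balaban1983Higgs3, (1.22) p.416] -/
theorem univ_extSLeg7 : (univ : Finset (ExtSLeg (g122g nbar hn))) = {es7 nbar hn 0, es7 nbar hn 1} := by
  ext l
  simp only [Finset.mem_univ, Finset.mem_insert, Finset.mem_singleton, true_iff]
  exact es7_cases l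

/-- The external-leg assignment of ⑦ with `es7 0` (the leg at `x`) at `r` and `es7 1` (the leg at `x′`) at `r′`.
[cite: Balaban1983Higgs3, (1.22) p.416] -/
def gExt {X : Type*} (r r' : X) : ExtSLeg (g122g nbar hn) → X := fun ℓ => if ℓ = es7 nbar hn 0 then r else r'

/-- values of `gExt`. [cite: Balaban1983Higgs3, (1.22) p.416] -/
theorem gExt_apply {X : Type*} (r r' : X) : gExt (hn := hn) r r' (es7 nbar hn 0) = r ∧ gExt (hn := hn) r r' (es7 nbar hn 1) = r' := by
  simp [gExt, (es7_ne (hn := hn)).symm]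

/-- the restriction of an assignment to the external legs of ⑦ is `gExt` of its values at `sx 0 1`, `sx 1 1`.
[cite: Balaban1983Higgs3, (1.22) p.416] -/
theorem ext_fun_eq7 {X : Type*} (α : SLeg kind122g → X) :
    (fun ℓ : ExtSLeg (g122g nbar hn) => α ℓ.1) = gExt (α (sx 0 1)) (α (sx 1 1)) := by
  funext ℓ
  obtain ⟨e0, e1⟩ := gExt_apply (hn := hn) (α (sx 0 1)) (α (sx 1 1))
  rcases es7_cases ℓ with h | h <;> rw [h]
  · exact e0.symm
  · exact e1.symm

/-- A product external field read at `gExt r r′`. [cite: Balaban1983Higgs3, p.419] -/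
theorem extS_gExt {P : HiggsLattice.Params} {N : ℕ} (φs : ExtSLeg (g122g nbar hn) → HiggsLattice.ScalarField P 0 N)
    (r r' : HiggsLattice.Site P 0 × Fin N) :
    extS (g122g nbar hn) φs (gExt r r') = φs (es7 nbar hn 0) r.1 r.2 * φs (es7 nbar hn 1) r'.1 r'.2 := by
  unfold extS
  obtain ⟨e0, e1⟩ := gExt_apply (hn := hn) r r'
  rw [show (∏ ℓ : ExtSLeg (g122g nbar hn), φs ℓ (gExt r r' ℓ).1 (gExt r r' ℓ).2) =
      ∏ ℓ ∈ ({es7 nbar hn 0, es7 nbar hn 1} : Finset _), φs ℓ (gExt r r' ℓ).1 (gExt r r' ℓ).2 by rw [← univ_extSLeg7],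
    Finset.prod_pair es7_ne, e0, e1]

/-- The PRODUCT external field of ⑦ with `φ` in the leg at `x` and `φ′` in the leg at `x′` (print's `Σ^ε(x − x′)` read between
`φ_a(x)` and `φ_b(x′)` as in (1.19)). [cite: Balaban1983Higgs3, (1.22) p.416] -/
def pairExt7 {P : HiggsLattice.Params} {N : ℕ} (φ φ' : HiggsLattice.ScalarField P 0 N) :
    ExtSLeg (g122g nbar hn) → HiggsLattice.ScalarField P 0 N :=
  fun ℓ => if ℓ = es7 nbar hn 0 then φ else φ'

/-- values of `pairExt7`. [cite: Balaban1983Higgs3, (1.22) p.416] -/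
theorem pairExt7_apply {P : HiggsLattice.Params} {N : ℕ} (φ φ' : HiggsLattice.ScalarField P 0 N) :
    pairExt7 (hn := hn) φ φ' (es7 nbar hn 0) = φ ∧ pairExt7 (hn := hn) φ φ' (es7 nbar hn 1) = φ' := by
  simp [pairExt7, (es7_ne (hn := hn)).symm]

end Legs

/-! ## §2 The vertex rules of ⑦ on basis fields; the index assignments of the six φ′-legs and the two A′-legs -/

section Basis

variable {P : HiggsLattice.Params} {N k : ℕ}

/-- **The polarized (1.7) on basis fields** (the first evaluation of this lineage with the mass-renormalization vertex): `−½ Σ_{x∈Ω₁}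
w(x) η^d δm_i²(x) (L^kε)² (δ_{p₀}(x)·δ_{p₁}(x))` = the Kronecker delta putting BOTH legs at `x` with a common internal index (any level
`j`) — the vertex (1.7) *"[with δm² instead of δm_i²(x)]"* of p. 416 in index form. [cite: Balaban1983Higgs3, (1.7) p.413]
[cite: Balaban1983Higgs3, (1.22) p.416] -/
theorem rule17_basisE {j : ℕ} (dm2 : HiggsLattice.Site P j → ℝ) (ell : ℝ) (Ω₁ : Finset (HiggsLattice.Site P j))
    (w : HiggsLattice.Site P j → ℝ) (p : Fin 2 → HiggsLattice.Site P j × Fin N) :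
    rule17 dm2 ell Ω₁ w (fun i => basisE (p i)) =
      ∑ x ∈ Ω₁, (-(1 / 2 : ℝ) * (w x * (P.mesh j ^ P.d * dm2 x * ell ^ 2))) *
        (if x = (p 0).1 ∧ x = (p 1).1 ∧ (p 0).2 = (p 1).2 then (1 : ℝ) else 0) := by
  unfold rule17
  simp only [inner_basisE]
  rw [Finset.mul_sum]
  exact Finset.sum_congr rfl fun x _ => by ring

variable [DecidableEq (HiggsLattice.PBond P 0)]

/-- **The rule (1.8)_{1,0} of the vertex `x` of ⑦ on basis fields** (prefactor `e·(−1)·η⁰/(1!0!) = −e`): `−e Σ_{b∈S} vterm` with FILE 5's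
`vterm` (localization weight, `η^d g_k(b₋)`, the site delta of the undifferentiated leg `sx 0 1`, the bond delta of the A′-leg `vb 0`,
the differentiated leg `sx 0 0` through `dq`). [cite: Balaban1983Higgs3, (1.8) p.413] -/
theorem rule18_basis7x (M : Model P N k) (w : HiggsLattice.PBond P 0 → ℝ)
    (α : SLeg kind122g → HiggsLattice.Site P 0 × Fin N) (β : VLeg kind122g → HiggsLattice.PBond P 0) :
    rule18 M.C M.g M.B M.At 1 0 M.S w (fun j => basisE (α ⟨0, j⟩)) (fun j => basisV (β ⟨0, j⟩)) =
      -M.C.e * ∑ b ∈ M.S, vterm M w b (α (sx 0 0)) (α (sx 0 1)) (β (vb 0)) := by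
  unfold rule18
  have hv : ∀ b, vlegs (n := 1) M.g (fun j : Fin 1 => basisV (β ⟨0, j⟩)) b = (if b = β (vb 0) then (1 : ℝ) else 0) * M.g b.src :=
    fun b => vlegs_one_basisV M.g _ (β (vb 0)) rfl b
  simp only [hv, pleg18_basisE, add_zero, pow_one, pow_zero, mul_one, Nat.cast_one, Nat.cast_zero, sub_self, zpow_zero,
    Nat.factorial_one, Nat.factorial_zero, div_one]
  rw [Finset.mul_sum, Finset.mul_sum]
  refine Finset.sum_congr rfl fun b _ => ?_
  unfold vterm dq
  simp only [sx]
  ring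

/-- **The rule (1.8)_{1,0} of the vertex `x′` of ⑦ on basis fields.** [cite: Balaban1983Higgs3, (1.8) p.413] -/
theorem rule18_basis7x' (M : Model P N k) (w : HiggsLattice.PBond P 0 → ℝ)
    (α : SLeg kind122g → HiggsLattice.Site P 0 × Fin N) (β : VLeg kind122g → HiggsLattice.PBond P 0) :
    rule18 M.C M.g M.B M.At 1 0 M.S w (fun j => basisE (α ⟨1, j⟩)) (fun j => basisV (β ⟨1, j⟩)) =
      -M.C.e * ∑ b ∈ M.S, vterm M w b (α (sx 1 0)) (α (sx 1 1)) (β (vb 1)) := by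
  unfold rule18
  have hv : ∀ b, vlegs (n := 1) M.g (fun j : Fin 1 => basisV (β ⟨1, j⟩)) b = (if b = β (vb 1) then (1 : ℝ) else 0) * M.g b.src :=
    fun b => vlegs_one_basisV M.g _ (β (vb 1)) rfl b
  simp only [hv, pleg18_basisE, add_zero, pow_one, pow_zero, mul_one, Nat.cast_one, Nat.cast_zero, sub_self, zpow_zero,
    Nat.factorial_one, Nat.factorial_zero, div_one]
  rw [Finset.mul_sum, Finset.mul_sum]
  refine Finset.sum_congr rfl fun b _ => ?_
  unfold vterm dq
  simp only [sx]
  ring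

omit [DecidableEq (HiggsLattice.PBond P 0)] in
/-- **The rule (1.7) of the vertex `x″` of ⑦ on basis fields**: `Σ_{x″∈Ω₁} (−½ w(x″) η^d δm²(x″) ℓ²)·[both legs at x″, same index]`.
[cite: Balaban1983Higgs3, (1.7) p.413] -/
theorem rule17_basis7 (M : Model P N k) (dm2 : HiggsLattice.Site P 0 → ℝ) (w : HiggsLattice.Site P 0 → ℝ)
    (α : SLeg kind122g → HiggsLattice.Site P 0 × Fin N) :
    rule17 dm2 M.ell M.Ω₁ w (fun j => basisE (α ⟨2, j⟩)) =
      ∑ x ∈ M.Ω₁, (-(1 / 2 : ℝ) * (w x * (P.mesh 0 ^ P.d * dm2 x * M.ell ^ 2))) *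
        (if x = (α (sx 2 0)).1 ∧ x = (α (sx 2 1)).1 ∧ (α (sx 2 0)).2 = (α (sx 2 1)).2 then (1 : ℝ) else 0) :=
  rule17_basisE dm2 M.ell M.Ω₁ w fun j => α (sx 2 j)

end Basis

section Assignments

variable {N : ℕ}

/-- kernel: a site delta on the first component of an index `(x, c)` leaves the sum over the internal index. [folklore] -/
private theorem sum_delta_fst {S : Type*} [Fintype S] [DecidableEq S] {N : ℕ} (x : S) (G : S × Fin N → ℝ) :
    ∑ r : S × Fin N, (if x = r.1 then (1 : ℝ) else 0) * G r = ∑ c : Fin N, G (x, c) := by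
  simp only [Fintype.sum_prod_type]
  rw [Finset.sum_eq_single x]
  · simp only [if_true, one_mul]
  · intro a _ ha
    simp only [if_neg (fun h : x = a => ha h.symm), zero_mul, Finset.sum_const_zero]
  · intro h
    exact absurd (Finset.mem_univ x) h

/-- kernel: the delta of the (1.7) vertex on a pair of indices `(s, s′)` — both sites at `x`, equal internal indices — leaves ONE sum over
the common internal index. [folklore] -/
private theorem sum_delta_pair {S : Type*} [Fintype S] [DecidableEq S] {N : ℕ} (x : S) (G : S × Fin N → S × Fin N → ℝ) :
    ∑ s : S × Fin N, ∑ s' : S × Fin N, (if x = s.1 ∧ x = s'.1 ∧ s.2 = s'.2 then (1 : ℝ) else 0) * G s s' =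
      ∑ a : Fin N, G (x, a) (x, a) := by
  have h1 : ∀ s s' : S × Fin N, (if x = s.1 ∧ x = s'.1 ∧ s.2 = s'.2 then (1 : ℝ) else 0) * G s s' =
      if x = s.1 then (if x = s'.1 then (if s.2 = s'.2 then G s s' else 0) else 0) else 0 := by
    intro s s'
    by_cases h : x = s.1 <;> by_cases h' : x = s'.1 <;> by_cases h'' : s.2 = s'.2 <;> simp [h, h', h'']
  simp only [h1, Fintype.sum_prod_type, Finset.sum_ite_irrel, Finset.sum_const_zero, Finset.sum_ite_eq, Finset.mem_univ, if_true]

/-- kernel: distinctness of the six φ′-legs, in the forms used below. [cite: Balaban1983Higgs3, (1.22) p.416] -/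
private theorem sx_ne : sx 1 0 ≠ sx 0 0 ∧ sx 0 1 ≠ sx 0 0 ∧ sx 0 1 ≠ sx 1 0 ∧ sx 1 1 ≠ sx 0 0 ∧ sx 1 1 ≠ sx 1 0 ∧ sx 1 1 ≠ sx 0 1 ∧
    sx 2 0 ≠ sx 0 0 ∧ sx 2 0 ≠ sx 1 0 ∧ sx 2 0 ≠ sx 0 1 ∧ sx 2 0 ≠ sx 1 1 ∧
    sx 2 1 ≠ sx 0 0 ∧ sx 2 1 ≠ sx 1 0 ∧ sx 2 1 ≠ sx 0 1 ∧ sx 2 1 ≠ sx 1 1 ∧ sx 2 1 ≠ sx 2 0 := by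
  decide

/-- The φ′-leg index assignment of ⑦ with prescribed values at the six legs (`r` on `sx 0 1`, `r′` on `sx 1 1`, `s` on `sx 2 0`, `s′` on
`sx 2 1`, `p` on `sx 0 0`, `p′` on `sx 1 0` — the legs carrying Kronecker deltas first). [cite: Balaban1983Higgs3, (1.22) p.416] -/
def gAssign {X : Type*} (r r' s s' p p' : X) : SLeg kind122g → X :=
  fun ℓ => if ℓ = sx 0 1 then r else if ℓ = sx 1 1 then r' else if ℓ = sx 2 0 then s else if ℓ = sx 2 1 then s'
    else if ℓ = sx 0 0 then p else p'

/-- values of `gAssign`. [cite: Balaban1983Higgs3, (1.22) p.416] -/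
theorem gAssign_apply {X : Type*} (r r' s s' p p' : X) :
    gAssign r r' s s' p p' (sx 0 1) = r ∧ gAssign r r' s s' p p' (sx 1 1) = r' ∧ gAssign r r' s s' p p' (sx 2 0) = s ∧
      gAssign r r' s s' p p' (sx 2 1) = s' ∧ gAssign r r' s s' p p' (sx 0 0) = p ∧ gAssign r r' s s' p p' (sx 1 0) = p' := by
  obtain ⟨h1, h2, h3, h4, h5, h6, h7, h8, h9, h10, h11, h12, h13, h14, h15⟩ := sx_ne
  simp [gAssign, h1, h6, h9, h10, h13, h14, h15, h2.symm, h3.symm, h4.symm, h5.symm, h7.symm, h8.symm, h11.symm, h12.symm]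

/-- The values at the six legs ↔ the φ′-leg index assignments of ⑦, as an equivalence. [cite: Balaban1983Higgs3, (1.22) p.416] -/
def gEquiv (X : Type*) : X × X × X × X × X × X ≃ (SLeg kind122g → X) where
  toFun q := gAssign q.1 q.2.1 q.2.2.1 q.2.2.2.1 q.2.2.2.2.1 q.2.2.2.2.2
  invFun α := (α (sx 0 1), α (sx 1 1), α (sx 2 0), α (sx 2 1), α (sx 0 0), α (sx 1 0))
  left_inv q := by
    obtain ⟨r, r', s, s', p, p'⟩ := q
    obtain ⟨e1, e2, e3, e4, e5, e6⟩ := gAssign_apply r r' s s' p p'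
    simp only [e1, e2, e3, e4, e5, e6]
  right_inv α := by
    funext ℓ
    obtain ⟨e1, e2, e3, e4, e5, e6⟩ := gAssign_apply (α (sx 0 1)) (α (sx 1 1)) (α (sx 2 0)) (α (sx 2 1)) (α (sx 0 0)) (α (sx 1 0))
    rcases sx_cases ℓ with h | h | h | h | h | h <;> rw [h]
    · exact e5
    · exact e6
    · exact e1
    · exact e2
    · exact e3
    · exact e4

/-- **Re-parametrizing the sum over the φ′-leg index assignments of ⑦ by the values at the six legs.** [cite: Balaban1983Higgs3, (1.22) p.416] -/
theorem sum_gAssign {X : Type*} [Fintype X] (F : (SLeg kind122g → X) → ℝ) :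
    ∑ α, F α = ∑ r : X, ∑ r' : X, ∑ s : X, ∑ s' : X, ∑ p : X, ∑ p' : X, F (gAssign r r' s s' p p') := by
  rw [← Fintype.sum_equiv (gEquiv X) (fun q => F (gEquiv X q)) F fun _ => rfl]
  simp only [Fintype.sum_prod_type]
  rfl

/-- **The sum over the φ′-leg assignments of ⑦ with its three Kronecker deltas**: the undifferentiated legs of `x`, `x′` sit at the
prescribed sites `x`, `x′` with free internal indices `c`, `c′`; the two legs of the (1.7) vertex sit at `x″` with ONE common internal
index `a`; the differentiated legs `sx 0 0`, `sx 1 0` run over all indices `p`, `p′`. [cite: Balaban1983Higgs3, (1.22) p.416] -/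
theorem alpha_sum7 {S : Type*} [Fintype S] [DecidableEq S] (x x' x'' : S)
    (F : S × Fin N → S × Fin N → S × Fin N → S × Fin N → S × Fin N → S × Fin N → ℝ) :
    ∑ α : SLeg kind122g → S × Fin N, (if x = (α (sx 0 1)).1 then (1 : ℝ) else 0) *
        ((if x' = (α (sx 1 1)).1 then (1 : ℝ) else 0) *
          ((if x'' = (α (sx 2 0)).1 ∧ x'' = (α (sx 2 1)).1 ∧ (α (sx 2 0)).2 = (α (sx 2 1)).2 then (1 : ℝ) else 0) *
            F (α (sx 0 0)) (α (sx 1 0)) (α (sx 0 1)) (α (sx 1 1)) (α (sx 2 0)) (α (sx 2 1)))) =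
      ∑ c : Fin N, ∑ c' : Fin N, ∑ a : Fin N, ∑ p : S × Fin N, ∑ p' : S × Fin N,
        F p p' (x, c) (x', c') (x'', a) (x'', a) := by
  rw [sum_gAssign]
  have happ : ∀ r r' s s' p p' : S × Fin N, gAssign r r' s s' p p' (sx 0 1) = r ∧ gAssign r r' s s' p p' (sx 1 1) = r' ∧
      gAssign r r' s s' p p' (sx 2 0) = s ∧ gAssign r r' s s' p p' (sx 2 1) = s' ∧ gAssign r r' s s' p p' (sx 0 0) = p ∧
        gAssign r r' s s' p p' (sx 1 0) = p' := fun r r' s s' p p' => gAssign_apply r r' s s' p p'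
  simp only [happ]
  simp only [← Finset.mul_sum]
  simp only [sum_delta_pair, sum_delta_fst]

/-- The A′-leg index assignment of ⑦ with the values `b` on `vb 0`, `b′` on `vb 1`. [cite: Balaban1983Higgs3, (1.22) p.416] -/
def bAssign7 {Y : Type*} (b b' : Y) : VLeg kind122g → Y := fun ℓ => if ℓ = vb 0 then b else b'

/-- values of `bAssign7`. [cite: Balaban1983Higgs3, (1.22) p.416] -/
theorem bAssign7_apply {Y : Type*} (b b' : Y) : bAssign7 b b' (vb 0) = b ∧ bAssign7 b b' (vb 1) = b' := by
  have h : vb 1 ≠ vb 0 := fun h => absurd (vb_injective h) (by decide)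
  simp [bAssign7, h]

/-- **The Kronecker sum over the A′-leg assignments of ⑦**: the two bond deltas of the polarized A′-legs put `vb 0` at `b` and `vb 1` at
`b′`. [cite: Balaban1983Higgs3, (1.22) p.416] -/
theorem beta_sum7 {Y : Type*} [Fintype Y] [DecidableEq Y] (b b' : Y) (F : (VLeg kind122g → Y) → ℝ) :
    ∑ β : VLeg kind122g → Y, (if b = β (vb 0) then (1 : ℝ) else 0) * ((if b' = β (vb 1) then (1 : ℝ) else 0) * F β) =
      F (bAssign7 b b') := by
  obtain ⟨e0, e1⟩ := bAssign7_apply b b'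
  rw [Finset.sum_eq_single (bAssign7 b b')]
  · rw [e0, e1, if_pos rfl, if_pos rfl, one_mul, one_mul]
  · intro β _ hβ
    by_cases h0 : b = β (vb 0)
    · by_cases h1 : b' = β (vb 1)
      · exfalso
        apply hβ
        funext ℓ
        rcases vb_cases ℓ with h | h <;> rw [h]
        · rw [e0]; exact h0.symm
        · rw [e1]; exact h1.symm
      · rw [if_neg h1, zero_mul, mul_zero]
    · rw [if_neg h0, zero_mul]
  · intro h
    exact absurd (Finset.mem_univ _) h

end Assignments

/-! ## §3 The evaluator on ⑦: the closed form -/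

section Eval

variable {P : HiggsLattice.Params} {N k : ℕ} {hn : 1 ≤ nbar}
variable [DecidableEq (HiggsLattice.PBond P 0)]

/-- The evaluator on ⑦ with `kind122g`-typed index assignments — FILE 1's `amp` unfolded. [cite: Balaban1983Higgs3, p.420] -/
theorem graphAmp_eq7 (M : Model P N k) (dm2 : Fin (g122g nbar hn).nV → HiggsLattice.Site P 0 → ℝ)
    (loc : Fin (g122g nbar hn).nV → Loc P k) (Po : OutPairing (g122g nbar hn))
    (Ks : SLine (g122g nbar hn) → HiggsLattice.Site P 0 × Fin N → HiggsLattice.Site P 0 × Fin N → ℝ)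
    (Kv : VLine (g122g nbar hn) → HiggsLattice.PBond P 0 → HiggsLattice.PBond P 0 → ℝ)
    (Ko : Po.Line oRank → HiggsLattice.Site P k × Fin N → HiggsLattice.Site P k × Fin N → ℝ)
    (Φ : (ExtSLeg (g122g nbar hn) → HiggsLattice.Site P 0 × Fin N) → ℝ) (A : (ExtVLeg (g122g nbar hn) → HiggsLattice.PBond P 0) → ℝ)
    (Ψ : (Po.Ext → HiggsLattice.Site P k × Fin N) → ℝ) :
    graphAmp (g122g nbar hn) M dm2 loc Po Ks Kv Ko Φ A Ψ =
      ∑ α : SLeg kind122g → HiggsLattice.Site P 0 × Fin N, ∑ β : VLeg kind122g → HiggsLattice.PBond P 0,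
        ∑ ο : OLeg kind122g → HiggsLattice.Site P k × Fin N,
          vertexFactor (rulesOf (g122g nbar hn) M dm2 loc) basisE basisV basisE α β ο *
            (Φ (fun ℓ => α ℓ.1) * A (fun ℓ => β ℓ.1) * Ψ (fun ℓ => ο ℓ.1)) *
            (sLineFactor Ks α * vLineFactor Kv β * oLineFactor Po Ko ο) := rfl

/-- kernel: five nested sums — two outer over finite types, three inner over finsets — commute. [folklore] -/
private theorem sum_comm5 {ι κ μ ν ξ : Type*} [Fintype ι] [Fintype κ] (s : Finset μ) (s' : Finset ν) (t : Finset ξ)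
    (F : ι → κ → μ → ν → ξ → ℝ) :
    ∑ α, ∑ β, ∑ b ∈ s, ∑ b' ∈ s', ∑ x ∈ t, F α β b b' x = ∑ b ∈ s, ∑ b' ∈ s', ∑ x ∈ t, ∑ α, ∑ β, F α β b b' x := by
  have h1 : ∀ α, ∑ β, ∑ b ∈ s, ∑ b' ∈ s', ∑ x ∈ t, F α β b b' x = ∑ b ∈ s, ∑ b' ∈ s', ∑ x ∈ t, ∑ β, F α β b b' x := by
    intro α
    rw [Finset.sum_comm]
    refine Finset.sum_congr rfl fun b _ => ?_
    rw [Finset.sum_comm]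
    exact Finset.sum_congr rfl fun b' _ => Finset.sum_comm
  simp only [h1]
  rw [Finset.sum_comm]
  refine Finset.sum_congr rfl fun b _ => ?_
  rw [Finset.sum_comm]
  refine Finset.sum_congr rfl fun b' _ => ?_
  exact Finset.sum_comm

/-- kernel: the product of the three vertex sums against the remaining factors, rearranged with the position sums outermost. [folklore] -/
private theorem rearrange3 {ι κ μ ν : Type*} [Fintype ι] [Fintype κ] (s : Finset μ) (t : Finset ν) (e : ℝ)
    (A₀ A₁ : μ → ι → κ → ℝ) (A₂ : ν → ι → ℝ) (X Y : ι → κ → ℝ) :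
    ∑ α, ∑ β, -e * (∑ b ∈ s, A₀ b α β) * (-e * ∑ b' ∈ s, A₁ b' α β) * (∑ x ∈ t, A₂ x α) * X α β * Y α β =
      e ^ 2 * ∑ b ∈ s, ∑ b' ∈ s, ∑ x ∈ t, ∑ α, ∑ β, A₀ b α β * (A₁ b' α β * (A₂ x α * (X α β * Y α β))) := by
  have h1 : ∀ α β, -e * (∑ b ∈ s, A₀ b α β) * (-e * ∑ b' ∈ s, A₁ b' α β) * (∑ x ∈ t, A₂ x α) * X α β * Y α β =
      ∑ b ∈ s, ∑ b' ∈ s, ∑ x ∈ t, e ^ 2 * (A₀ b α β * (A₁ b' α β * (A₂ x α * (X α β * Y α β)))) := by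
    intro α β
    rw [show -e * (∑ b ∈ s, A₀ b α β) * (-e * ∑ b' ∈ s, A₁ b' α β) * (∑ x ∈ t, A₂ x α) * X α β * Y α β =
        (e ^ 2 * (X α β * Y α β)) * ((∑ b ∈ s, A₀ b α β) * ((∑ b' ∈ s, A₁ b' α β) * ∑ x ∈ t, A₂ x α)) by ring,
      Finset.sum_mul_sum, Finset.sum_mul]
    simp only [Finset.mul_sum]
    exact Finset.sum_congr rfl fun b _ => Finset.sum_congr rfl fun b' _ => Finset.sum_congr rfl fun x _ => by ring
  simp only [h1]
  rw [sum_comm5]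
  simp only [← Finset.mul_sum]

/-- **The evaluator EVALUATED on the picture ⑦ of (1.22)** (two vertices (1.8)_{1,0} at the bonds `b ∋ x`, `b′ ∋ x′`, the
mass-renormalization vertex (1.7) at the site `x″`; the A-line *"replaced by the corresponding propagator"* `Kv(b,b′)`; the φ-line `ℓ_a`
from the differentiated leg of `x` to `x″` and the φ-line `ℓ_b` from the differentiated leg of `x′` to `x″`, each differentiated at its
(1.8)-end (FILE 6's `dK1`) and carrying at `x″` the COMMON internal index `a` of the scalar product `|φ(x″)|²` of (1.7); external: the
undifferentiated legs of `x`, `x′` at `(b₋, c)`, `(b′₋, c′)`): for the model data `M`, the localization weights `w₀`, `w₁` (bonds) and `w₂`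
(sites) of the three vertices, the counterterm `δm²₂` of the vertex `x″`, ANY line kernels and ANY joint external field `Φ`,
`E = A(∅)Ψ(∅) · e² Σ_{b,b′∈S} Σ_{x″∈Ω₁} w₀(b)w₁(b′)w₂(x″) η^{3d} g_k(b₋)g_k(b′₋) (−½ δm²₂(x″) (L^kε)²) Kv(b,b′)
Σ_{c,c′,a} dK1(Ks ℓ_a)(b, qe_c; (x″,a)) · dK1(Ks ℓ_b)(b′, qe_{c′}; (x″,a)) · Φ((b₋,c),(b′₋,c′))` — the factor `(−e)² = e²` of the two vertices
(1.8)_{1,0} and the factor `−½ δm² (L^kε)² η^d` of the polarized (1.7). [cite: Balaban1983Higgs3, (1.22) p.416] [cite: Balaban1983Higgs3, (1.7) p.413]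
[cite: Balaban1983Higgs3, (1.8) p.413] [cite: Balaban1983Higgs3, p.414] -/
theorem graphAmp_g122g (M : Model P N k) (dm2 : Fin (g122g nbar hn).nV → HiggsLattice.Site P 0 → ℝ)
    (loc : Fin (g122g nbar hn).nV → Loc P k) (Po : OutPairing (g122g nbar hn))
    (Ks : SLine (g122g nbar hn) → HiggsLattice.Site P 0 × Fin N → HiggsLattice.Site P 0 × Fin N → ℝ)
    (Kv : VLine (g122g nbar hn) → HiggsLattice.PBond P 0 → HiggsLattice.PBond P 0 → ℝ)
    (Ko : Po.Line oRank → HiggsLattice.Site P k × Fin N → HiggsLattice.Site P k × Fin N → ℝ)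
    (Φ : (ExtSLeg (g122g nbar hn) → HiggsLattice.Site P 0 × Fin N) → ℝ) (A : (ExtVLeg (g122g nbar hn) → HiggsLattice.PBond P 0) → ℝ)
    (Ψ : (Po.Ext → HiggsLattice.Site P k × Fin N) → ℝ) :
    graphAmp (g122g nbar hn) M dm2 loc Po Ks Kv Ko Φ A Ψ =
      (A (fun ℓ => isEmptyElim ℓ) * Ψ (fun ℓ => isEmptyElim ℓ)) *
        (M.C.e ^ 2 * ∑ b ∈ M.S, ∑ b' ∈ M.S, ∑ x'' ∈ M.Ω₁,
          (loc (vx7 nbar hn 0)).wB b * (loc (vx7 nbar hn 1)).wB b' * (loc (vx7 nbar hn 2)).wS x'' *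
          ((P.mesh 0 ^ P.d) ^ 3 * (M.g b.src * M.g b'.src) * (-(1 / 2 : ℝ) * dm2 (vx7 nbar hn 2) x'' * M.ell ^ 2) *
            Kv (lv nbar hn) b b' *
            ∑ c : Fin N, ∑ c' : Fin N, ∑ a : Fin N,
              dK1 M.C M.B (Ks (la nbar hn)) b (M.C.q (EuclideanSpace.single c (1 : ℝ))) (x'', a) *
                dK1 M.C M.B (Ks (lb nbar hn)) b' (M.C.q (EuclideanSpace.single c' (1 : ℝ))) (x'', a) *
                  Φ (gExt (b.src, c) (b'.src, c')))) := by
  haveI : IsEmpty (Po.Line oRank) := ⟨fun l => IsEmpty.false l.1⟩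
  haveI : IsEmpty Po.Ext := ⟨fun l => IsEmpty.false l.1⟩
  have hV : ∀ (α : SLeg kind122g → HiggsLattice.Site P 0 × Fin N) (β : VLeg kind122g → HiggsLattice.PBond P 0)
      (ο : OLeg kind122g → HiggsLattice.Site P k × Fin N),
      vertexFactor (rulesOf (g122g nbar hn) M dm2 loc) basisE basisV basisE α β ο =
        rule18 M.C M.g M.B M.At 1 0 M.S (loc (vx7 nbar hn 0)).wB (fun j => basisE (α ⟨0, j⟩)) (fun j => basisV (β ⟨0, j⟩)) *
          rule18 M.C M.g M.B M.At 1 0 M.S (loc (vx7 nbar hn 1)).wB (fun j => basisE (α ⟨1, j⟩)) (fun j => basisV (β ⟨1, j⟩)) *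
          rule17 (dm2 (vx7 nbar hn 2)) M.ell M.Ω₁ (loc (vx7 nbar hn 2)).wS (fun j => basisE (α ⟨2, j⟩)) := by
    intro α β ο
    unfold vertexFactor
    exact Fin.prod_univ_three _
  have hs : ∀ α : SLeg kind122g → HiggsLattice.Site P 0 × Fin N,
      sLineFactor Ks α = Ks (la nbar hn) (α (sx 0 0)) (α (sx 2 0)) * Ks (lb nbar hn) (α (sx 1 0)) (α (sx 2 1)) := by
    intro α
    unfold sLineFactor
    rw [show (∏ l : SLine (g122g nbar hn), Ks l (α l.1) (α ((sPairing (g122g nbar hn)).mate l.1))) =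
        ∏ l ∈ ({la nbar hn, lb nbar hn} : Finset (SLine (g122g nbar hn))), Ks l (α l.1) (α ((sPairing (g122g nbar hn)).mate l.1)) by
          rw [← univ_sline7], Finset.prod_pair la_ne_lb]
    show Ks (la nbar hn) (α (sx 0 0)) (α ((sPairing (g122g nbar hn)).mate (sx 0 0))) *
        Ks (lb nbar hn) (α (sx 1 0)) (α ((sPairing (g122g nbar hn)).mate (sx 1 0))) = _
    rw [mate7.1, mate7.2.1]
  have hv : ∀ β : VLeg kind122g → HiggsLattice.PBond P 0, vLineFactor Kv β = Kv (lv nbar hn) (β (vb 0)) (β (vb 1)) := by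
    intro β
    unfold vLineFactor
    rw [Fintype.prod_unique]
    show Kv (lv nbar hn) (β (vb 0)) (β ((vPairing (g122g nbar hn)).mate (vb 0))) = _
    rw [mate7.2.2]
  have ho : ∀ ο : OLeg kind122g → HiggsLattice.Site P k × Fin N, oLineFactor Po Ko ο = 1 := by
    intro ο
    unfold oLineFactor
    exact Fintype.prod_empty _
  have hA : ∀ β : VLeg kind122g → HiggsLattice.PBond P 0, (fun ℓ : ExtVLeg (g122g nbar hn) => β ℓ.1) = fun ℓ => isEmptyElim ℓ :=
    fun β => funext fun ℓ => isEmptyElim ℓ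
  have hΨ : ∀ ο : OLeg kind122g → HiggsLattice.Site P k × Fin N, (fun ℓ : Po.Ext => ο ℓ.1) = fun ℓ => isEmptyElim ℓ :=
    fun ο => funext fun ℓ => isEmptyElim ℓ
  rw [graphAmp_eq7]
  simp only [Fintype.sum_unique, hV, hs, hv, ho, hA, hΨ, mul_one, rule18_basis7x, rule18_basis7x', rule17_basis7, ext_fun_eq7]
  -- position sums outermost
  have h := rearrange3 M.S M.Ω₁ M.C.e
    (fun b (α : SLeg kind122g → HiggsLattice.Site P 0 × Fin N) (β : VLeg kind122g → HiggsLattice.PBond P 0) =>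
      vterm M (loc (vx7 nbar hn 0)).wB b (α (sx 0 0)) (α (sx 0 1)) (β (vb 0)))
    (fun b (α : SLeg kind122g → HiggsLattice.Site P 0 × Fin N) (β : VLeg kind122g → HiggsLattice.PBond P 0) =>
      vterm M (loc (vx7 nbar hn 1)).wB b (α (sx 1 0)) (α (sx 1 1)) (β (vb 1)))
    (fun x'' (α : SLeg kind122g → HiggsLattice.Site P 0 × Fin N) =>
      (-(1 / 2 : ℝ) * ((loc (vx7 nbar hn 2)).wS x'' * (P.mesh 0 ^ P.d * dm2 (vx7 nbar hn 2) x'' * M.ell ^ 2))) *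
        (if x'' = (α (sx 2 0)).1 ∧ x'' = (α (sx 2 1)).1 ∧ (α (sx 2 0)).2 = (α (sx 2 1)).2 then (1 : ℝ) else 0))
    (fun α _ => Φ (gExt (α (sx 0 1)) (α (sx 1 1))) * A (fun ℓ => isEmptyElim ℓ) * Ψ (fun ℓ => isEmptyElim ℓ))
    (fun α β => Ks (la nbar hn) (α (sx 0 0)) (α (sx 2 0)) * Ks (lb nbar hn) (α (sx 1 0)) (α (sx 2 1)) *
      Kv (lv nbar hn) (β (vb 0)) (β (vb 1)))
  beta_reduce at h
  rw [h, mul_left_comm _ (M.C.e ^ 2) _]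
  congr 1
  rw [Finset.mul_sum]
  refine Finset.sum_congr rfl fun b _ => ?_
  rw [Finset.mul_sum]
  refine Finset.sum_congr rfl fun b' _ => ?_
  rw [Finset.mul_sum]
  refine Finset.sum_congr rfl fun x'' _ => ?_
  -- the summand with the bond deltas, the site deltas and the (1.7) delta in front
  have h2 : ∀ (α : SLeg kind122g → HiggsLattice.Site P 0 × Fin N) (β : VLeg kind122g → HiggsLattice.PBond P 0),
      vterm M (loc (vx7 nbar hn 0)).wB b (α (sx 0 0)) (α (sx 0 1)) (β (vb 0)) *
          (vterm M (loc (vx7 nbar hn 1)).wB b' (α (sx 1 0)) (α (sx 1 1)) (β (vb 1)) *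
            ((-(1 / 2 : ℝ) * ((loc (vx7 nbar hn 2)).wS x'' * (P.mesh 0 ^ P.d * dm2 (vx7 nbar hn 2) x'' * M.ell ^ 2))) *
                (if x'' = (α (sx 2 0)).1 ∧ x'' = (α (sx 2 1)).1 ∧ (α (sx 2 0)).2 = (α (sx 2 1)).2 then (1 : ℝ) else 0) *
              (Φ (gExt (α (sx 0 1)) (α (sx 1 1))) * A (fun ℓ => isEmptyElim ℓ) * Ψ (fun ℓ => isEmptyElim ℓ) *
                (Ks (la nbar hn) (α (sx 0 0)) (α (sx 2 0)) * Ks (lb nbar hn) (α (sx 1 0)) (α (sx 2 1)) *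
                  Kv (lv nbar hn) (β (vb 0)) (β (vb 1)))))) =
        (if b = β (vb 0) then (1 : ℝ) else 0) * ((if b' = β (vb 1) then (1 : ℝ) else 0) *
          (Kv (lv nbar hn) (β (vb 0)) (β (vb 1)) * (((A (fun ℓ => isEmptyElim ℓ) * Ψ (fun ℓ => isEmptyElim ℓ)) * (((loc (vx7 nbar hn 0)).wB b * (P.mesh 0 ^ P.d * M.g b.src)) * (((loc (vx7 nbar hn 1)).wB b' * (P.mesh 0 ^ P.d * M.g b'.src)) * (-(1 / 2 : ℝ) * ((loc (vx7 nbar hn 2)).wS x'' * (P.mesh 0 ^ P.d * dm2 (vx7 nbar hn 2) x'' * M.ell ^ 2)))))) *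
            ((if b.src = (α (sx 0 1)).1 then (1 : ℝ) else 0) *
              ((if b'.src = (α (sx 1 1)).1 then (1 : ℝ) else 0) *
                ((if x'' = (α (sx 2 0)).1 ∧ x'' = (α (sx 2 1)).1 ∧ (α (sx 2 0)).2 = (α (sx 2 1)).2 then (1 : ℝ) else 0) *
                (dq M.C M.B (α (sx 0 0)) b (α (sx 0 1)).2 * dq M.C M.B (α (sx 1 0)) b' (α (sx 1 1)).2 *
                  Ks (la nbar hn) (α (sx 0 0)) (α (sx 2 0)) * Ks (lb nbar hn) (α (sx 1 0)) (α (sx 2 1)) * Φ (gExt (α (sx 0 1)) (α (sx 1 1)))))))))) := by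
    intro α β
    unfold vterm
    ring
  rw [Finset.sum_congr rfl fun α _ => Finset.sum_congr rfl fun β _ => h2 α β]
  -- the A′-leg sum: the A-line kernel between b and b′
  have h3 : ∀ α : SLeg kind122g → HiggsLattice.Site P 0 × Fin N,
      ∑ β : VLeg kind122g → HiggsLattice.PBond P 0, (if b = β (vb 0) then (1 : ℝ) else 0) * ((if b' = β (vb 1) then (1 : ℝ) else 0) *
          (Kv (lv nbar hn) (β (vb 0)) (β (vb 1)) * (((A (fun ℓ => isEmptyElim ℓ) * Ψ (fun ℓ => isEmptyElim ℓ)) * (((loc (vx7 nbar hn 0)).wB b * (P.mesh 0 ^ P.d * M.g b.src)) * (((loc (vx7 nbar hn 1)).wB b' * (P.mesh 0 ^ P.d * M.g b'.src)) * (-(1 / 2 : ℝ) * ((loc (vx7 nbar hn 2)).wS x'' * (P.mesh 0 ^ P.d * dm2 (vx7 nbar hn 2) x'' * M.ell ^ 2)))))) *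
            ((if b.src = (α (sx 0 1)).1 then (1 : ℝ) else 0) *
              ((if b'.src = (α (sx 1 1)).1 then (1 : ℝ) else 0) *
                ((if x'' = (α (sx 2 0)).1 ∧ x'' = (α (sx 2 1)).1 ∧ (α (sx 2 0)).2 = (α (sx 2 1)).2 then (1 : ℝ) else 0) *
                (dq M.C M.B (α (sx 0 0)) b (α (sx 0 1)).2 * dq M.C M.B (α (sx 1 0)) b' (α (sx 1 1)).2 *
                  Ks (la nbar hn) (α (sx 0 0)) (α (sx 2 0)) * Ks (lb nbar hn) (α (sx 1 0)) (α (sx 2 1)) * Φ (gExt (α (sx 0 1)) (α (sx 1 1)))))))))) =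
        Kv (lv nbar hn) b b' * (((A (fun ℓ => isEmptyElim ℓ) * Ψ (fun ℓ => isEmptyElim ℓ)) * (((loc (vx7 nbar hn 0)).wB b * (P.mesh 0 ^ P.d * M.g b.src)) * (((loc (vx7 nbar hn 1)).wB b' * (P.mesh 0 ^ P.d * M.g b'.src)) * (-(1 / 2 : ℝ) * ((loc (vx7 nbar hn 2)).wS x'' * (P.mesh 0 ^ P.d * dm2 (vx7 nbar hn 2) x'' * M.ell ^ 2)))))) *
            ((if b.src = (α (sx 0 1)).1 then (1 : ℝ) else 0) *
              ((if b'.src = (α (sx 1 1)).1 then (1 : ℝ) else 0) *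
                ((if x'' = (α (sx 2 0)).1 ∧ x'' = (α (sx 2 1)).1 ∧ (α (sx 2 0)).2 = (α (sx 2 1)).2 then (1 : ℝ) else 0) *
                (dq M.C M.B (α (sx 0 0)) b (α (sx 0 1)).2 * dq M.C M.B (α (sx 1 0)) b' (α (sx 1 1)).2 *
                  Ks (la nbar hn) (α (sx 0 0)) (α (sx 2 0)) * Ks (lb nbar hn) (α (sx 1 0)) (α (sx 2 1)) * Φ (gExt (α (sx 0 1)) (α (sx 1 1)))))))) := by
    intro α
    rw [beta_sum7]
    rw [(bAssign7_apply b b').1, (bAssign7_apply b b').2]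
  rw [Finset.sum_congr rfl fun α _ => h3 α, ← Finset.mul_sum, ← Finset.mul_sum]
  -- the φ′-leg sum
  have h4 := alpha_sum7 (N := N) b.src b'.src x'' fun p p' r r' s s' =>
    dq M.C M.B p b r.2 * dq M.C M.B p' b' r'.2 * Ks (la nbar hn) p s * Ks (lb nbar hn) p' s' * Φ (gExt r r')
  beta_reduce at h4
  rw [h4]
  -- the two index forms of the φ-lines agree
  have h5 : ∀ (c c' a : Fin N), ∑ p : HiggsLattice.Site P 0 × Fin N, ∑ p' : HiggsLattice.Site P 0 × Fin N,
      dq M.C M.B p b (b.src, c).2 * dq M.C M.B p' b' (b'.src, c').2 * Ks (la nbar hn) p (x'', a) * Ks (lb nbar hn) p' (x'', a) *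
        Φ (gExt (b.src, c) (b'.src, c')) =
      dK1 M.C M.B (Ks (la nbar hn)) b (M.C.q (EuclideanSpace.single c (1 : ℝ))) (x'', a) *
        dK1 M.C M.B (Ks (lb nbar hn)) b' (M.C.q (EuclideanSpace.single c' (1 : ℝ))) (x'', a) * Φ (gExt (b.src, c) (b'.src, c')) := by
    intro c c' a
    rw [dK1_single, dK1_single, Finset.sum_mul_sum, Finset.sum_mul]
    simp only [Finset.sum_mul]
    exact Finset.sum_congr rfl fun p _ => Finset.sum_congr rfl fun p' _ => by ring
  simp only [h5]
  ring

/-- **⑦ for a product external field** (`φs (es7 0)` in the leg at `x`, `φs (es7 1)` in the leg at `x′`): the internal indices of the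
two external legs are summed INTO the fields (FILE 6's `sum_dK1_single`), leaving the one index `a` of the (1.7) scalar product:
`E = A(∅)Ψ(∅) · e² Σ_{b,b′∈S} Σ_{x″∈Ω₁} w₀w₁w₂ η^{3d} g_kg_k (−½ δm²₂(x″)(L^kε)²) Kv(b,b′) Σ_a dK1(Ks ℓ_a)(b, qφ₀(b₋); (x″,a)) ·
dK1(Ks ℓ_b)(b′, qφ₁(b′₋); (x″,a))`. [cite: Balaban1983Higgs3, (1.22) p.416] [cite: Balaban1983Higgs3, (1.8) p.413] -/
theorem graphAmp_g122g_extS (M : Model P N k) (dm2 : Fin (g122g nbar hn).nV → HiggsLattice.Site P 0 → ℝ)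
    (loc : Fin (g122g nbar hn).nV → Loc P k) (Po : OutPairing (g122g nbar hn))
    (Ks : SLine (g122g nbar hn) → HiggsLattice.Site P 0 × Fin N → HiggsLattice.Site P 0 × Fin N → ℝ)
    (Kv : VLine (g122g nbar hn) → HiggsLattice.PBond P 0 → HiggsLattice.PBond P 0 → ℝ)
    (Ko : Po.Line oRank → HiggsLattice.Site P k × Fin N → HiggsLattice.Site P k × Fin N → ℝ)
    (φs : ExtSLeg (g122g nbar hn) → HiggsLattice.ScalarField P 0 N) (A : (ExtVLeg (g122g nbar hn) → HiggsLattice.PBond P 0) → ℝ)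
    (Ψ : (Po.Ext → HiggsLattice.Site P k × Fin N) → ℝ) :
    graphAmp (g122g nbar hn) M dm2 loc Po Ks Kv Ko (extS (g122g nbar hn) φs) A Ψ =
      (A (fun ℓ => isEmptyElim ℓ) * Ψ (fun ℓ => isEmptyElim ℓ)) *
        (M.C.e ^ 2 * ∑ b ∈ M.S, ∑ b' ∈ M.S, ∑ x'' ∈ M.Ω₁,
          (loc (vx7 nbar hn 0)).wB b * (loc (vx7 nbar hn 1)).wB b' * (loc (vx7 nbar hn 2)).wS x'' *
          ((P.mesh 0 ^ P.d) ^ 3 * (M.g b.src * M.g b'.src) * (-(1 / 2 : ℝ) * dm2 (vx7 nbar hn 2) x'' * M.ell ^ 2) *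
            Kv (lv nbar hn) b b' *
            ∑ a : Fin N, dK1 M.C M.B (Ks (la nbar hn)) b (M.C.q (φs (es7 nbar hn 0) b.src)) (x'', a) *
              dK1 M.C M.B (Ks (lb nbar hn)) b' (M.C.q (φs (es7 nbar hn 1) b'.src)) (x'', a))) := by
  rw [graphAmp_g122g]
  have h : ∀ (b b' : HiggsLattice.PBond P 0) (x'' : HiggsLattice.Site P 0),
      ∑ c : Fin N, ∑ c' : Fin N, ∑ a : Fin N,
        dK1 M.C M.B (Ks (la nbar hn)) b (M.C.q (EuclideanSpace.single c (1 : ℝ))) (x'', a) *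
          dK1 M.C M.B (Ks (lb nbar hn)) b' (M.C.q (EuclideanSpace.single c' (1 : ℝ))) (x'', a) *
            (φs (es7 nbar hn 0) b.src c * φs (es7 nbar hn 1) b'.src c') =
      ∑ a : Fin N, dK1 M.C M.B (Ks (la nbar hn)) b (M.C.q (φs (es7 nbar hn 0) b.src)) (x'', a) *
        dK1 M.C M.B (Ks (lb nbar hn)) b' (M.C.q (φs (es7 nbar hn 1) b'.src)) (x'', a) := by
    intro b b' x''
    have h1 : ∀ a : Fin N, dK1 M.C M.B (Ks (la nbar hn)) b (M.C.q (φs (es7 nbar hn 0) b.src)) (x'', a) *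
        dK1 M.C M.B (Ks (lb nbar hn)) b' (M.C.q (φs (es7 nbar hn 1) b'.src)) (x'', a) =
        ∑ c : Fin N, ∑ c' : Fin N, dK1 M.C M.B (Ks (la nbar hn)) b (M.C.q (EuclideanSpace.single c (1 : ℝ))) (x'', a) *
          dK1 M.C M.B (Ks (lb nbar hn)) b' (M.C.q (EuclideanSpace.single c' (1 : ℝ))) (x'', a) *
            (φs (es7 nbar hn 0) b.src c * φs (es7 nbar hn 1) b'.src c') := by
      intro a
      rw [← sum_dK1_single M.C M.B (Ks (la nbar hn)) b M.C.q (φs (es7 nbar hn 0) b.src) (x'', a),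
        ← sum_dK1_single M.C M.B (Ks (lb nbar hn)) b' M.C.q (φs (es7 nbar hn 1) b'.src) (x'', a), Finset.sum_mul_sum]
      exact Finset.sum_congr rfl fun c _ => Finset.sum_congr rfl fun c' _ => by ring
    simp only [h1]
    conv_rhs => rw [Finset.sum_comm]
    exact Finset.sum_congr rfl fun c _ => Finset.sum_comm
  simp only [extS_gExt, h]

end Eval

/-! ## §4 Zero background, free kernels: the value, and print's seventh term of (1.22) -/

section Free

variable {P : HiggsLattice.Params} {N k : ℕ} {hn : 1 ≤ nbar}

/-- kernel: the real inner product of `W = ℝ^N` in coordinates. [folklore] -/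
private theorem inner_eq_sum_coord (u v : HiggsCovariance.E N) : ⟪u, v⟫_ℝ = ∑ a : Fin N, u a * v a := by
  rw [PiLp.inner_apply]
  exact Finset.sum_congr rfl fun a _ => by simp [mul_comm]

/-- kernel: a sum over the positively oriented bonds is the sum over initial points and directions. [folklore] -/
private theorem sum_bond {j : ℕ} (F : HiggsLattice.PBond P j → ℝ) :
    ∑ b, F b = ∑ x : HiggsLattice.Site P j, ∑ μ : Fin P.d, F ⟨x, μ⟩ := by
  let e : HiggsLattice.Site P j × Fin P.d ≃ HiggsLattice.PBond P j :=
    ⟨fun p => ⟨p.1, p.2⟩, fun b => (b.src, b.dir), fun _ => rfl, fun _ => rfl⟩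
  rw [← Fintype.sum_equiv e (fun p => F ⟨p.1, p.2⟩) F fun _ => rfl, Fintype.sum_prod_type]

/-- **THE SEVENTH TERM OF (1.22) as a bilinear form in the external fields**, on the (Higgs)₂,₃ torus carrier: print's
*"e² Σ_{μ=1}^d Σ_{x″∈T_ε} ε^d q(∂^ε_μC^ε_0)(x − x″) δm² (C^ε_0∂^{ε*}_μ)(x″ − x′) q C^ε(x − x′)"* (p. 416) inserted between `φ(x)` and
`φ′(x′)` and summed `Σ_{x,x′} ε^{2d}`: the φ-line kernel differentiated at `x` in its first variable (FILE 6's `dKernelL` = r15's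
`d1Kernel`) from `x` to the (1.7) vertex at `x″`, the counterterm `δm²(x″)` (print: the number δm²; a site function as in
`B3Eq123Counterterms.sig7`), the φ-line kernel from `x″` to `x′` differentiated at `x′` in its second variable (`dKernelR` = r15's `dAdjKernel`),
the A-line `C(x,x′)`, `q…q` as the operator `q²` between the fields — `B3Eq123Counterterms.sig7` RESTATED symbol by symbol on this carrier.
[cite: Balaban1983Higgs3, (1.22) p.416] -/
def seventh122T (ε e : ℝ) (q : HiggsCovariance.E N →L[ℝ] HiggsCovariance.E N) (dm2 : HiggsLattice.Site P 0 → ℝ)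
    (C₀ C : HiggsLattice.Site P 0 → HiggsLattice.Site P 0 → ℝ) (φ φ' : HiggsLattice.ScalarField P 0 N) : ℝ :=
  e ^ 2 * ∑ x : HiggsLattice.Site P 0, ∑ x' : HiggsLattice.Site P 0, ε ^ (2 * P.d) *
    ((∑ μ : Fin P.d, ∑ x'' : HiggsLattice.Site P 0, ε ^ P.d * (dKernelL ε⁻¹ μ C₀ x x'' * dm2 x'' * dKernelR ε⁻¹ μ C₀ x'' x')) *
      C x x' * ⟪φ x, q (q (φ' x'))⟫_ℝ)

variable [DecidableEq (HiggsLattice.PBond P 0)]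

/-- **E(⑦) AT ZERO BACKGROUND WITH THE FREE KERNELS**: for `B̃ = 0`, all bonds and all sites, site-valued localizations `g₀`, `g₁` (read at
`b₋`) and `g₂` of the three vertices, the free kernels `G_a ⊗ 1_N`, `G_b ⊗ 1_N` on the two φ-lines and the direction-diagonal
`[μ = μ′]G(b₋,b′₋)` on the A-line (HYPOTHESES on the supplied kernels), and the product external field (`φ` at `x`, `φ′` at `x′`):
`E = A(∅)Ψ(∅)·e²·((L^kε)²/2)·η^{3d}·Σ_{x,μ} Σ_{x′} Σ_{x″} g₀g_k(x) g₁g_k(x′) g₂(x″) δm²₂(x″) G(x,x′) (∂^η_μG_a)(x,x″) (∂^η_μG_b)(x′,x″) φ(x)·q²φ′(x′)`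
— both φ-lines differentiated in their FIRST variable at the (1.8) end (as the evaluator reads them, from the lower endpoint); the closed
index chain `qφ·qφ′ = −φ·q²φ′` (`inner_q_q`) turns the `−½` of (1.7) into `+½`. [cite: Balaban1983Higgs3, (1.22) p.416] -/
theorem graphAmp_g122g_free (M : Model P N k) (hB : M.B = 0) (hS : M.S = Finset.univ) (hΩ : M.Ω₁ = Finset.univ)
    (dm2 : Fin (g122g nbar hn).nV → HiggsLattice.Site P 0 → ℝ) (loc : Fin (g122g nbar hn).nV → Loc P k)
    (g₀ g₁ g₂ : HiggsLattice.Site P 0 → ℝ) (hw₀ : ∀ b, (loc (vx7 nbar hn 0)).wB b = g₀ b.src)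
    (hw₁ : ∀ b, (loc (vx7 nbar hn 1)).wB b = g₁ b.src) (hw₂ : ∀ x, (loc (vx7 nbar hn 2)).wS x = g₂ x)
    (Po : OutPairing (g122g nbar hn)) (Ks : SLine (g122g nbar hn) → HiggsLattice.Site P 0 × Fin N → HiggsLattice.Site P 0 × Fin N → ℝ)
    (Kv : VLine (g122g nbar hn) → HiggsLattice.PBond P 0 → HiggsLattice.PBond P 0 → ℝ)
    (Ko : Po.Line oRank → HiggsLattice.Site P k × Fin N → HiggsLattice.Site P k × Fin N → ℝ)
    (Ga Gb G : HiggsLattice.Site P 0 → HiggsLattice.Site P 0 → ℝ)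
    (hKa : ∀ p p', Ks (la nbar hn) p p' = if p.2 = p'.2 then Ga p.1 p'.1 else 0)
    (hKb : ∀ p p', Ks (lb nbar hn) p p' = if p.2 = p'.2 then Gb p.1 p'.1 else 0)
    (hKv : ∀ b b', Kv (lv nbar hn) b b' = if b.dir = b'.dir then G b.src b'.src else 0)
    (φ φ' : HiggsLattice.ScalarField P 0 N) (A : (ExtVLeg (g122g nbar hn) → HiggsLattice.PBond P 0) → ℝ)
    (Ψ : (Po.Ext → HiggsLattice.Site P k × Fin N) → ℝ) :
    graphAmp (g122g nbar hn) M dm2 loc Po Ks Kv Ko (extS (g122g nbar hn) (pairExt7 φ φ')) A Ψ =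
      (A (fun ℓ => isEmptyElim ℓ) * Ψ (fun ℓ => isEmptyElim ℓ)) *
        (M.C.e ^ 2 * (M.ell ^ 2 / 2) * (P.mesh 0 ^ P.d) ^ 3 *
          ∑ x : HiggsLattice.Site P 0, ∑ μ : Fin P.d, ∑ x' : HiggsLattice.Site P 0, ∑ x'' : HiggsLattice.Site P 0,
            g₀ x * M.g x * (g₁ x' * M.g x') * g₂ x'' * dm2 (vx7 nbar hn 2) x'' * G x x' *
              (dKernelL (P.mesh 0)⁻¹ μ Ga x x'' * dKernelL (P.mesh 0)⁻¹ μ Gb x' x'' * ⟪φ x, M.C.q (M.C.q (φ' x'))⟫_ℝ)) := by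
  rw [graphAmp_g122g_extS]
  obtain ⟨e0, e1⟩ := pairExt7_apply (hn := hn) φ φ'
  have hKa' : Ks (la nbar hn) = fun p p' => if p.2 = p'.2 then Ga p.1 p'.1 else 0 := funext fun p => funext fun p' => hKa p p'
  have hKb' : Ks (lb nbar hn) = fun p p' => if p.2 = p'.2 then Gb p.1 p'.1 else 0 := funext fun p => funext fun p' => hKb p p'
  simp only [e0, e1, hw₀, hw₁, hw₂, hKv, hKa', hKb', hS, hΩ, hB]
  congr 1
  rw [sum_bond]
  simp only [sum_bond, dK1_zero_free]
  -- the direction delta of the A-line and the internal-index contraction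
  have h1 : ∀ (x : HiggsLattice.Site P 0) (μ : Fin P.d) (x' : HiggsLattice.Site P 0),
      ∑ μ' : Fin P.d, ∑ x'' : HiggsLattice.Site P 0, g₀ x * g₁ x' * g₂ x'' *
          ((P.mesh 0 ^ P.d) ^ 3 * (M.g x * M.g x') * (-(1 / 2 : ℝ) * dm2 (vx7 nbar hn 2) x'' * M.ell ^ 2) *
            (if μ = μ' then G x x' else 0) *
            ∑ a : Fin N, dKernelL (P.mesh 0)⁻¹ μ Ga x x'' * (M.C.q (φ x)) a * (dKernelL (P.mesh 0)⁻¹ μ' Gb x' x'' * (M.C.q (φ' x')) a)) =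
        ∑ x'' : HiggsLattice.Site P 0, M.ell ^ 2 / 2 * ((P.mesh 0 ^ P.d) ^ 3 *
          (g₀ x * M.g x * (g₁ x' * M.g x') * g₂ x'' * dm2 (vx7 nbar hn 2) x'' * G x x' *
            (dKernelL (P.mesh 0)⁻¹ μ Ga x x'' * dKernelL (P.mesh 0)⁻¹ μ Gb x' x'' * ⟪φ x, M.C.q (M.C.q (φ' x'))⟫_ℝ))) := by
    intro x μ x'
    rw [Finset.sum_comm]
    refine Finset.sum_congr rfl fun x'' _ => ?_
    have h2 : ∀ μ' : Fin P.d, g₀ x * g₁ x' * g₂ x'' *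
          ((P.mesh 0 ^ P.d) ^ 3 * (M.g x * M.g x') * (-(1 / 2 : ℝ) * dm2 (vx7 nbar hn 2) x'' * M.ell ^ 2) *
            (if μ = μ' then G x x' else 0) *
            ∑ a : Fin N, dKernelL (P.mesh 0)⁻¹ μ Ga x x'' * (M.C.q (φ x)) a * (dKernelL (P.mesh 0)⁻¹ μ' Gb x' x'' * (M.C.q (φ' x')) a)) =
        if μ = μ' then g₀ x * g₁ x' * g₂ x'' *
          ((P.mesh 0 ^ P.d) ^ 3 * (M.g x * M.g x') * (-(1 / 2 : ℝ) * dm2 (vx7 nbar hn 2) x'' * M.ell ^ 2) * G x x' *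
            ∑ a : Fin N, dKernelL (P.mesh 0)⁻¹ μ Ga x x'' * (M.C.q (φ x)) a * (dKernelL (P.mesh 0)⁻¹ μ' Gb x' x'' * (M.C.q (φ' x')) a))
        else 0 := by
      intro μ'
      by_cases h : μ = μ' <;> simp [h]
    simp only [h2, Finset.sum_ite_eq, Finset.mem_univ, if_true]
    have h3 : ∑ a : Fin N, dKernelL (P.mesh 0)⁻¹ μ Ga x x'' * (M.C.q (φ x)) a * (dKernelL (P.mesh 0)⁻¹ μ Gb x' x'' * (M.C.q (φ' x')) a) =
        dKernelL (P.mesh 0)⁻¹ μ Ga x x'' * dKernelL (P.mesh 0)⁻¹ μ Gb x' x'' * ⟪M.C.q (φ x), M.C.q (φ' x')⟫_ℝ := by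
      rw [inner_eq_sum_coord, Finset.mul_sum]
      exact Finset.sum_congr rfl fun a _ => by ring
    rw [h3, inner_q_q]
    ring
  simp only [h1]
  simp only [← Finset.mul_sum]
  ring

/-- **E(⑦) AGAINST THE SEVENTH TERM OF (1.22)** at print's data of p. 416 (*"η = ε … B̃ = 0, g_k = 1"*, `L^kε = 1`, all bonds and
sites of `T_ε`, trivial localizations, `C^ε_0 ⊗ 1_N` on BOTH φ-lines with `C^ε_0` SYMMETRIC — so that the evaluator's first-variable
difference at `x′` IS print's `(C^ε_0∂^{ε*}_μ)(x″ − x′)` (FILE 6's `dKernelL_of_symm`) —, `δ_{μμ′}C^ε` on the A-line):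
`E = A(∅)Ψ(∅) · ½ · seventh122T` — the coefficient the kernel finds is ONE HALF (the `½` of the vertex (1.7) `½δm²|φ|²`: the drawn picture
fixes one of the two attachments of its legs; p. 416: *"we did not write … combinatoric factors before the graphs, understanding that they
are a part of the graphical description"*), and the SIGN is print's `+` (`(−e)²·(−½)·(qφ·qφ′ = −φ·q²φ′)`). [cite: Balaban1983Higgs3, (1.22) p.416] -/
theorem graphAmp_g122g_print (M : Model P N k) (hB : M.B = 0) (hS : M.S = Finset.univ) (hΩ : M.Ω₁ = Finset.univ)
    (hg : M.g = fun _ => 1) (hell : M.ell = 1)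
    (dm2 : Fin (g122g nbar hn).nV → HiggsLattice.Site P 0 → ℝ) (loc : Fin (g122g nbar hn).nV → Loc P k)
    (hw₀ : ∀ b, (loc (vx7 nbar hn 0)).wB b = 1) (hw₁ : ∀ b, (loc (vx7 nbar hn 1)).wB b = 1) (hw₂ : ∀ x, (loc (vx7 nbar hn 2)).wS x = 1)
    (Po : OutPairing (g122g nbar hn)) (Ks : SLine (g122g nbar hn) → HiggsLattice.Site P 0 × Fin N → HiggsLattice.Site P 0 × Fin N → ℝ)
    (Kv : VLine (g122g nbar hn) → HiggsLattice.PBond P 0 → HiggsLattice.PBond P 0 → ℝ)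
    (Ko : Po.Line oRank → HiggsLattice.Site P k × Fin N → HiggsLattice.Site P k × Fin N → ℝ)
    (C₀ C : HiggsLattice.Site P 0 → HiggsLattice.Site P 0 → ℝ) (hC₀ : ∀ y y', C₀ y y' = C₀ y' y)
    (hKa : ∀ p p', Ks (la nbar hn) p p' = if p.2 = p'.2 then C₀ p.1 p'.1 else 0)
    (hKb : ∀ p p', Ks (lb nbar hn) p p' = if p.2 = p'.2 then C₀ p.1 p'.1 else 0)
    (hKv : ∀ b b', Kv (lv nbar hn) b b' = if b.dir = b'.dir then C b.src b'.src else 0)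
    (φ φ' : HiggsLattice.ScalarField P 0 N) (A : (ExtVLeg (g122g nbar hn) → HiggsLattice.PBond P 0) → ℝ)
    (Ψ : (Po.Ext → HiggsLattice.Site P k × Fin N) → ℝ) :
    graphAmp (g122g nbar hn) M dm2 loc Po Ks Kv Ko (extS (g122g nbar hn) (pairExt7 φ φ')) A Ψ =
      (A (fun ℓ => isEmptyElim ℓ) * Ψ (fun ℓ => isEmptyElim ℓ)) *
        (1 / 2 * seventh122T (P.mesh 0) M.C.e M.C.q (dm2 (vx7 nbar hn 2)) C₀ C φ φ') := by
  rw [graphAmp_g122g_free M hB hS hΩ dm2 loc (fun _ => 1) (fun _ => 1) (fun _ => 1) (fun b => hw₀ b) (fun b => hw₁ b)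
    (fun x => hw₂ x) Po Ks Kv Ko C₀ C₀ C hKa hKb hKv φ φ' A Ψ, hg, hell]
  congr 1
  unfold seventh122T
  simp only [one_pow, one_mul, mul_one]
  have key : ∑ x : HiggsLattice.Site P 0, ∑ μ : Fin P.d, ∑ x' : HiggsLattice.Site P 0, ∑ x'' : HiggsLattice.Site P 0,
      dm2 (vx7 nbar hn 2) x'' * C x x' *
        (dKernelL (P.mesh 0)⁻¹ μ C₀ x x'' * dKernelL (P.mesh 0)⁻¹ μ C₀ x' x'' * ⟪φ x, M.C.q (M.C.q (φ' x'))⟫_ℝ) =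
      ∑ x : HiggsLattice.Site P 0, ∑ x' : HiggsLattice.Site P 0, ∑ μ : Fin P.d, ∑ x'' : HiggsLattice.Site P 0,
        dm2 (vx7 nbar hn 2) x'' * C x x' *
          (dKernelL (P.mesh 0)⁻¹ μ C₀ x x'' * dKernelR (P.mesh 0)⁻¹ μ C₀ x'' x' * ⟪φ x, M.C.q (M.C.q (φ' x'))⟫_ℝ) := by
    refine Finset.sum_congr rfl fun x _ => ?_
    rw [Finset.sum_comm]
    refine Finset.sum_congr rfl fun x' _ => Finset.sum_congr rfl fun μ _ => Finset.sum_congr rfl fun x'' _ => ?_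
    rw [dKernelL_of_symm (P.mesh 0)⁻¹ μ C₀ hC₀ x' x'']
  rw [key]
  simp only [Finset.mul_sum, Finset.sum_mul]
  refine Finset.sum_congr rfl fun x _ => Finset.sum_congr rfl fun x' _ => Finset.sum_congr rfl fun μ _ =>
    Finset.sum_congr rfl fun x'' _ => ?_
  ring

end Free

end

end Literature.MathematicalPhysics.QuantumFieldTheory.Balaban1983to89.B3Eq122MassInsertionFromFeynmanRules
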